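import Mathlib
import HarnessLib
import Summits.HubbardSuperconductivity.HubbardSuperconductivity.Theses.ChiralWindow
import Literature.MathematicalPhysics.QuantumLattice.DWaveOrderParameterProofs
import Literature.MathematicalPhysics.QuantumLattice.PairFieldMomentum

/-!
# Sketch — crux `CwChiralConstruction` (stmt-HubbardSuperconductivity-1740), crux-ideate round 1, ideator 2

First lemmas of the three idea cards (signatures over existing declarations; `sorry`'d, they only have
to elaborate):

* L1 `probeDomination_fin` / `probeDomination_orderParameter` (card `chiral-thermometer-probe-domination`);
* L2 `gapContinuation_fin` / `gapContinuation_floor` (card `josephson-gap-continuation`);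
* L3 `densitySupergradient_fin` / `measureSelection` (card `lebesgue-selection-free-density-clause`).
-/

namespace Summit.HubbardSuperconductivity.HubbardSuperconductivity.Cruxes.CwChiralConstruction.Ideator2

open Literature.MathematicalPhysics.QuantumLattice Literature.Probability.LatticeModels Matrix Filter MeasureTheory
open scoped Matrix.Norms.L2Operator ComplexOrder Topology

/-! ### L1 — probe domination ("chiral thermometer") -/

/-- L1, finite volume (provable now from `Matrix.groundEnergy_le_groundStateFunctional_re`,
`groundEnergy_source_le_of_re_eq_zero`, `abs_re_groundStateFunctional_le_norm`): for ANY probe `B` whose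
symmetrised one-point function vanishes in the source-free tracial ground state (e.g. any charge-`2`
operator: a complex two-channel `d + iX` pair field, with triplet or `T`-odd admixtures), the energy
GAIN of the `B₁g`-sourced torus dominates `h` times the `B₁g` amplitude read off the `B`-sourced ground
state, up to `h'‖B + Bᴴ‖`. -/
theorem probeDomination_fin (L : ℕ) [NeZero L] (U μ h h' : ℝ)
    (B : Matrix (Finset (Orb (FermionTorus 2 L))) (Finset (Orb (FermionTorus 2 L))) ℂ)
    (hh' : 0 ≤ h')
    (hB : ((hubbardTorusWith 2 L 1 U μ).groundStateFunctional (B + Bᴴ)).re = 0) :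
    h * ((hubbardTorusWith 2 L 1 U μ - (h' : ℂ) • (B + Bᴴ)).groundStateFunctional
          (pairField dWaveFormFactor L + (pairField dWaveFormFactor L)ᴴ)).re - h' * ‖B + Bᴴ‖ ≤
      (hubbardTorusWith 2 L 1 U μ).groundEnergy - (dWaveSourceTorus L U μ h).groundEnergy := by
  have hK : (hubbardTorusWith 2 L 1 U μ).IsHermitian := isHermitian_hubbardTorusWith L 1 U μ
  have hOB : (B + Bᴴ).IsHermitian := isHermitian_add_transpose_self B
  have hA : (hubbardTorusWith 2 L 1 U μ - (h' : ℂ) • (B + Bᴴ)).IsHermitian :=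
    isHermitian_sub_real_smul hK hOB h'
  have hHd : (dWaveSourceTorus L U μ h).IsHermitian := dWaveSourceTorus_isHermitian L hK h
  -- the `B`-sourced ground state is a trial state for the `d`-sourced Hamiltonian
  have h1 := Matrix.groundEnergy_le_groundStateFunctional_re hA hHd
  have hdec : dWaveSourceTorus L U μ h =
      (hubbardTorusWith 2 L 1 U μ - (h' : ℂ) • (B + Bᴴ)) + (h' : ℂ) • (B + Bᴴ) -
        (h : ℂ) • (pairField dWaveFormFactor L + (pairField dWaveFormFactor L)ᴴ) := by
    rw [sub_add_cancel]; rfl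
  rw [hdec, map_sub, map_add, map_smul, map_smul, Matrix.groundStateFunctional_hamiltonian hA] at h1
  simp only [Complex.add_re, Complex.sub_re, Complex.ofReal_re, smul_eq_mul, Complex.re_ofReal_mul] at h1
  -- the probe never raises the energy above the source-free ground energy
  have h3 : (hubbardTorusWith 2 L 1 U μ - (h' : ℂ) • (B + Bᴴ)).groundEnergy ≤
      (hubbardTorusWith 2 L 1 U μ).groundEnergy :=
    groundEnergy_source_le_of_re_eq_zero hK hOB hB h'
  -- a priori bound on the probe's one-point function
  have h4 : h' * ((hubbardTorusWith 2 L 1 U μ - (h' : ℂ) • (B + Bᴴ)).groundStateFunctional (B + Bᴴ)).re ≤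
      h' * ‖B + Bᴴ‖ :=
    mul_le_mul_of_nonneg_left ((le_abs_self _).trans (abs_re_groundStateFunctional_le_norm hA _)) hh'
  rw [hdec]
  linarith

/-- L1, order-parameter form (from `probeDomination_fin` + the tree lever
`le_dWaveOrderParameter_of_le_liminf_energyGain`): the Koma–Tasaki `B₁g` order parameter dominates the
`B₁g` amplitude prepared by ANY vanishing extensive probe family `B_L` — one may measure `d`-wave order
with a chiral (`d + iX`, `T`-odd, possibly triplet-admixed) thermometer. -/
theorem probeDomination_orderParameter (U μ b ε : ℝ)
    (B : ∀ L : ℕ, Matrix (Finset (Orb (FermionTorus 2 (L + 1)))) (Finset (Orb (FermionTorus 2 (L + 1)))) ℂ)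
    (hB0 : ∀ L, ((hubbardTorusWith 2 (L + 1) 1 U μ).groundStateFunctional (B L + (B L)ᴴ)).re = 0)
    (hBn : ∀ L, ‖B L + (B L)ᴴ‖ ≤ b * ((L + 1 : ℕ) : ℝ) ^ 2)
    (hε : ∃ h₀ : ℝ, 0 < h₀ ∧ ∀ h' ∈ Set.Ioo (0 : ℝ) h₀,
      ε ≤ liminf (fun L : ℕ =>
        ((hubbardTorusWith 2 (L + 1) 1 U μ - (h' : ℂ) • (B L + (B L)ᴴ)).groundStateFunctional
            (pairField dWaveFormFactor (L + 1))).re / ((L + 1 : ℕ) : ℝ) ^ 2) atTop) :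
    ε ≤ dWaveOrderParameter U μ := by
  obtain ⟨h₀, hh₀, hfloor⟩ := hε
  -- the a priori constant `B_d = 2 Σ_e |d e/√2|`
  set Bd : ℝ := 2 * ∑ e ∈ insert (0 : Site 2) unitSteps, |dWaveFormFactor e / Real.sqrt 2| with hBd
  have hb : 0 ≤ b := by
    have h1 := hBn 0
    have h2 : (0 : ℝ) ≤ ‖B 0 + (B 0)ᴴ‖ := norm_nonneg _
    have h3 : ((0 + 1 : ℕ) : ℝ) ^ 2 = 1 := by norm_num
    rw [h3, mul_one] at h1
    linarith
  refine le_dWaveOrderParameter_of_le_liminf_energyGain U μ one_pos fun h hh => ?_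
  have hhpos : 0 < h := hh.1
  -- it suffices to prove `ε - η ≤ liminf` for every `η > 0`
  apply le_of_forall_pos_le_add
  intro η hη
  -- choose the probe strength
  set h' : ℝ := min (h₀ / 2) (h * η / (b + 1)) with hh'def
  have hh'pos : 0 < h' := lt_min (by linarith) (by positivity)
  have hh'lt : h' < h₀ := (min_le_left _ _).trans_lt (by linarith)
  have hh'le : h' ≤ h * η / (b + 1) := min_le_right _ _
  have hcorr : h' * b / (2 * h) ≤ η := by
    rw [div_le_iff₀ (by positivity)]
    have hb1 : 0 < b + 1 := by linarith
    have : h' * (b + 1) ≤ h * η := by rwa [le_div_iff₀ hb1] at hh'le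
    nlinarith
  have hF := hfloor h' ⟨hh'pos, hh'lt⟩
  -- pointwise comparison, for every `L`
  have hpt : ∀ L : ℕ,
      ((hubbardTorusWith 2 (L + 1) 1 U μ - (h' : ℂ) • (B L + (B L)ᴴ)).groundStateFunctional
            (pairField dWaveFormFactor (L + 1))).re / ((L + 1 : ℕ) : ℝ) ^ 2 - η ≤
        ((dWaveSourceTorus (L + 1) U μ 0).groundEnergy - (dWaveSourceTorus (L + 1) U μ h).groundEnergy) /
          (2 * h * (((L + 1 : ℕ) : ℝ)) ^ 2) := by
    intro L
    have hL : (0 : ℝ) < ((L + 1 : ℕ) : ℝ) ^ 2 := cast_sq_pos_of_neZero (L + 1)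
    have key := probeDomination_fin (L + 1) U μ h h' (B L) hh'pos.le (hB0 L)
    have hA : (hubbardTorusWith 2 (L + 1) 1 U μ - (h' : ℂ) • (B L + (B L)ᴴ)).IsHermitian :=
      isHermitian_sub_real_smul (isHermitian_hubbardTorusWith (L + 1) 1 U μ)
        (isHermitian_add_transpose_self (B L)) h'
    rw [map_add, Complex.add_re, Matrix.groundStateFunctional_conjTranspose_re] at key
    rw [dWaveSourceTorus_zero]
    have hn := hBn L
    rw [div_sub' (hc := hL.ne'), div_le_div_iff₀ hL (by positivity)]
    have hhn : h' * ‖B L + (B L)ᴴ‖ ≤ h' * (b * ((L + 1 : ℕ) : ℝ) ^ 2) :=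
      mul_le_mul_of_nonneg_left hn hh'pos.le
    have hc2 : h' * b * ((L + 1 : ℕ) : ℝ) ^ 2 ≤ 2 * h * η * ((L + 1 : ℕ) : ℝ) ^ 2 := by
      refine mul_le_mul_of_nonneg_right ?_ hL.le
      rw [div_le_iff₀ (by positivity)] at hcorr
      linarith
    nlinarith [hL]
  -- `g` is bounded above (cobounded) and `F'` bounded below: the liminf comparison
  have hup : ∀ L : ℕ,
      ((dWaveSourceTorus (L + 1) U μ 0).groundEnergy - (dWaveSourceTorus (L + 1) U μ h).groundEnergy) /
          (2 * h * (((L + 1 : ℕ) : ℝ)) ^ 2) ≤ Bd := fun L =>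
    (energyGain_div_le_dWaveSourceDensity (L := L + 1) U μ hhpos).trans (dWaveSourceDensity_le_const (L + 1) U μ h)
  have hlow : ∀ L : ℕ, -Bd ≤
      ((hubbardTorusWith 2 (L + 1) 1 U μ - (h' : ℂ) • (B L + (B L)ᴴ)).groundStateFunctional
            (pairField dWaveFormFactor (L + 1))).re / ((L + 1 : ℕ) : ℝ) ^ 2 := by
    intro L
    have hL : (0 : ℝ) < ((L + 1 : ℕ) : ℝ) ^ 2 := cast_sq_pos_of_neZero (L + 1)
    have hA : (hubbardTorusWith 2 (L + 1) 1 U μ - (h' : ℂ) • (B L + (B L)ᴴ)).IsHermitian :=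
      isHermitian_sub_real_smul (isHermitian_hubbardTorusWith (L + 1) 1 U μ)
        (isHermitian_add_transpose_self (B L)) h'
    have h1 := abs_re_groundStateFunctional_le_norm hA (pairField dWaveFormFactor (L + 1))
    have h2 := norm_pairField_le dWaveFormFactor (L + 1)
    rw [le_div_iff₀ hL]
    have := (abs_le.1 (h1.trans h2)).1
    linarith
  have hmain : ε - η ≤ liminf (fun L : ℕ =>
      ((dWaveSourceTorus (L + 1) U μ 0).groundEnergy - (dWaveSourceTorus (L + 1) U μ h).groundEnergy) /
        (2 * h * (((L + 1 : ℕ) : ℝ)) ^ 2)) atTop := by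
    refine le_of_forall_lt_imp_le_of_dense fun a ha => ?_
    have ha' : a + η < liminf (fun L : ℕ =>
        ((hubbardTorusWith 2 (L + 1) 1 U μ - (h' : ℂ) • (B L + (B L)ᴴ)).groundStateFunctional
            (pairField dWaveFormFactor (L + 1))).re / ((L + 1 : ℕ) : ℝ) ^ 2) atTop := by linarith
    have hev := eventually_lt_of_lt_liminf ha'
      (isBoundedUnder_of_eventually_ge (Eventually.of_forall hlow))
    refine le_liminf_of_le (isCoboundedUnder_ge_of_eventually_le atTop (Eventually.of_forall hup)) ?_
    filter_upwards [hev] with L hLt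
    have := hpt L
    linarith
  linarith

/-! ### L2 — Josephson-gap continuation -/

/-- L2, finite-dimensional core (provable now; Hellmann–Feynman + second-order/Temple lower bound
on a fine partition): along a segment of source strengths on which `K - sO` keeps a UNIQUE ground state
with gap `≥ γ` and the connected fluctuation of `O` stays `≤ V`, the sourced one-point function moves by at
most `4 (b - a) V / γ` (its slope is the static susceptibility `χ(s) = 2 Σ_{n>0} |⟨n|O|0⟩|²/(Eₙ - E₀) ≤ 2V/γ`). -/
theorem gapContinuation_fin {n : Type*} [Fintype n] [DecidableEq n] [Nonempty n]
    (K O : Matrix n n ℂ) (hK : K.IsHermitian) (hO : O.IsHermitian) (a b γ V : ℝ)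
    (hab : a ≤ b) (hγ : 0 < γ) (hV : 0 ≤ V)
    (hgap : ∀ s ∈ Set.Icc a b, (K - (s : ℂ) • O).HasSpectralGap γ)
    (hvar : ∀ s ∈ Set.Icc a b,
      ((K - (s : ℂ) • O).groundStateFunctional (O * O)).re -
        ((K - (s : ℂ) • O).groundStateFunctional O).re ^ 2 ≤ V) :
    ((K - (b : ℂ) • O).groundStateFunctional O).re - ((K - (a : ℂ) • O).groundStateFunctional O).re ≤
      4 * (b - a) * V / γ := by
  sorry

/-- L2, the continuation floor for the order parameter (dyadic use of `gapContinuation_fin` with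
`γ(s) = c √s` — the Josephson-pendulum / pinned-Goldstone gap — and `V(s) ≤ C (1 + |log s|) L²`, then
monotonicity in `h` and the tree's staircase lemma `le_dWaveOrderParameter_of_forall`): an ANCHOR floor at
one source value `h₁` plus the two spectral hypotheses on `(0, h₁]` give a floor at `h ↓ 0`.  Stated for the
`B₁g` source itself with the cluster gap above a ground multiplet of size `≤ 1` (unique ground state); the
card explains why in the chiral window one runs it on a chirality-resolving probe (L1) instead. -/
theorem gapContinuation_floor (U μ c C h₁ ε : ℝ) (hc : 0 < c) (hC : 0 ≤ C) (hh₁ : 0 < h₁)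
    (hgap : ∀ a b : ℝ, 0 < a → a ≤ b → b ≤ h₁ → ∃ L₀ : ℕ, ∀ L : ℕ, L₀ ≤ L → ∀ s ∈ Set.Icc a b,
      (dWaveSourceTorus (L + 1) U μ s).HasSpectralGap (c * Real.sqrt s))
    (hvar : ∀ a b : ℝ, 0 < a → a ≤ b → b ≤ h₁ → ∃ L₀ : ℕ, ∀ L : ℕ, L₀ ≤ L → ∀ s ∈ Set.Icc a b,
      ((dWaveSourceTorus (L + 1) U μ s).groundStateFunctional
            ((pairField dWaveFormFactor (L + 1) + (pairField dWaveFormFactor (L + 1))ᴴ) *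
              (pairField dWaveFormFactor (L + 1) + (pairField dWaveFormFactor (L + 1))ᴴ))).re -
          ((dWaveSourceTorus (L + 1) U μ s).groundStateFunctional
            (pairField dWaveFormFactor (L + 1) + (pairField dWaveFormFactor (L + 1))ᴴ)).re ^ 2 ≤
        C * (1 + |Real.log s|) * ((L + 1 : ℕ) : ℝ) ^ 2)
    (hanchor : ε + 20 * C * Real.sqrt h₁ * (1 + |Real.log h₁|) / c ≤
      liminf (fun L : ℕ => dWaveSourceDensity (L + 1) U μ h₁) atTop) :
    ε ≤ dWaveOrderParameter U μ := by
  sorry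

/-! ### L3 — Lebesgue selection: the density clause is free under `∀ U ∃ δ ∃ μ` -/

/-- L3, finite volume (provable now, same proof as `sub_mul_re_groundStateFunctional_le` with `O := N`):
minus the tracial ground-state density is a supergradient of the concave function
`μ ↦ E₀(H(1,U) - μN)`. -/
theorem densitySupergradient_fin (L : ℕ) [NeZero L] (U μ μ' : ℝ) :
    (hubbardTorusWith 2 L 1 U μ').groundEnergy ≤ (hubbardTorusWith 2 L 1 U μ).groundEnergy -
      (μ' - μ) * ((hubbardTorusWith 2 L 1 U μ).groundStateFunctional totalNumber).re := by
  have hK : (hubbardTorusWith 2 L 1 U μ).IsHermitian := isHermitian_hubbardTorusWith L 1 U μ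
  have hN : (totalNumber : Matrix (Finset (Orb (FermionTorus 2 L))) (Finset (Orb (FermionTorus 2 L))) ℂ).IsHermitian :=
    totalNumber_isHermitian
  have key := sub_mul_re_groundStateFunctional_le hK hN 0 (μ' - μ)
  have hdec : hubbardTorusWith 2 L 1 U μ' =
      hubbardTorusWith 2 L 1 U μ - ((μ' - μ : ℝ) : ℂ) • totalNumber := by
    rw [hubbardTorusWith_eq, hubbardTorusWith_eq, Complex.ofReal_sub, sub_smul]
    abel
  simp only [Complex.ofReal_zero, zero_smul, sub_zero] at key
  rw [hdec]
  linarith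

/-- L3, the selection lemma (Griffiths' lemma for concave limits + a.e. differentiability of concave
functions + `densitySupergradient_fin`): if the grand-canonical ground-state energy density converges to
a (necessarily concave) `e`, the densities `-e'` on a `μ`-interval lie in the summit's window
`[1 - 12/25, 1 - 3/10]`, and the order-parameter floor holds on a subset of that interval of POSITIVE
Lebesgue measure, then the crux's matrix at this `U` holds: some `δ ∈ [3/10, 12/25]` and `μ` have a
CONVERGENT density `→ 1 - δ` together with the floor.  (No location of the crossing line, no exclusion
of first-order density jumps, no continuity in `δ` is needed.) -/
theorem measureSelection (U ε μ₁ μ₂ : ℝ) (e : ℝ → ℝ) (hμ : μ₁ < μ₂)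
    (hlim : ∀ μ : ℝ, Tendsto (fun L : ℕ =>
      (hubbardTorusWith 2 (L + 1) 1 U μ).groundEnergy / ((L + 1 : ℕ) : ℝ) ^ 2) atTop (𝓝 (e μ)))
    (hwin : ∀ μ ∈ Set.Ioo μ₁ μ₂, DifferentiableAt ℝ e μ → -deriv e μ ∈ Set.Icc (1 - 12/25 : ℝ) (1 - 3/10))
    (hpos : 0 < volume {μ : ℝ | μ ∈ Set.Ioo μ₁ μ₂ ∧ ε ≤ dWaveOrderParameter U μ}) :
    ∃ δ ∈ Set.Icc (3/10 : ℝ) (12/25), ∃ μ : ℝ,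
      Tendsto (fun L : ℕ => ((hubbardTorusWith 2 (L + 1) 1 U μ).groundStateFunctional totalNumber).re /
        ((L + 1 : ℕ) : ℝ) ^ 2) atTop (𝓝 (1 - δ)) ∧ ε ≤ dWaveOrderParameter U μ := by
  sorry

/-- L3 ⇒ crux, bookkeeping: the crux follows from a UNIFORM-in-`U` version of the selection hypotheses
with `ε = exp(-C/U²)` (pure logic over `measureSelection`; shows the lemma's conclusion is literally the
crux's matrix). -/
theorem crux_of_measureSelection
    (H : ∃ U₀ : ℝ, 0 < U₀ ∧ ∃ C : ℝ, 0 < C ∧ ∀ U ∈ Set.Ioo (0 : ℝ) U₀,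
      ∃ δ ∈ Set.Icc (3/10 : ℝ) (12/25), ∃ μ : ℝ,
        Tendsto (fun L : ℕ => ((hubbardTorusWith 2 (L + 1) 1 U μ).groundStateFunctional totalNumber).re /
          ((L + 1 : ℕ) : ℝ) ^ 2) atTop (𝓝 (1 - δ)) ∧ Real.exp (-C / U ^ 2) ≤ dWaveOrderParameter U μ) :
    Summit.HubbardSuperconductivity.HubbardSuperconductivity.Theses.ChiralWindow.CwChiralConstruction := by
  obtain ⟨U₀, hU₀, C, hC, h⟩ := H
  exact ⟨U₀, hU₀, C, hC, fun U hU => h U hU⟩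

end Summit.HubbardSuperconductivity.HubbardSuperconductivity.Cruxes.CwChiralConstruction.Ideator2
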